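import Literature.NumberTheory.Transcendental.SigmaJets
import HarnessLib

/-!
# The theta model of the universal vectorial extension `E♮`

Topic: `Literature/NumberTheory/Transcendental`. Second brick (W2b in the plan of the unit
`provefact-Literature.NumberTheory.Transcendental.H-b596640137`, fact
`Literature.NumberTheory.Transcendental.HuberWustholzOnePeriods`) of the theta model of the groups
`M_κ = 𝔾ₘ^β × P_κ` (`SemistableQuotients.lean`) on which Baker–Wüstholz's Semistability Theorem
(`semistabilityTheorem_std_tors`, `SemistableTorsion.lean`) is to be proved by Baker's method.

For a period pair `L` with curve `E : y² = 4x³ - g₂x - g₃`, the universal vectorial extension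
`E♮` has `Lie E♮_ℂ = ℂ²` with coordinates `(z, t)` and exponential
`exp_{E♮}(z, t) = (℘(z), ℘′(z), ν)`, `ν = t - ζ(z)`, kernel `Λ♮ = {(ω, η(ω))}`
(`AnalyticSubgroupElliptic.lean`). The six functions

`σ³ · (1, ℘, ℘′, ν, ℘ν, ℘′ν - 2℘²)`  of `(z, t)`

are ENTIRE on `ℂ²`: they are the projective coordinates of `E♮` in the complete linear system
`|3·F₀ + D_∞|` of its compactification `Ē♮ = E♮ ⊔ D_∞` (the `ℙ¹`-bundle over `E` obtained by
compactifying the fibres `𝔾ₐ`; `F₀` = fibre over `0 ∈ E`), whose sections are the functions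
`a + bν`, `a, b` elliptic with poles only at `0`, `ord₀ b ≤ 3`, `ord₀(a - bζ) ≤ 3` — for
`b = ℘′` the correction `a = -2℘²` is forced by `℘′ζ + 2℘² = O(1)` at `0`. In terms of the sigma
jets `σ, σ′, σ″, σ‴` (`SigmaJets.lean`) they are the explicit polynomials

* `P₀ = σ³`, `P₁ = σ(σ′² - σσ″) = σ³℘`, `P₂ = 3σσ′σ″ - 2σ′³ - σ²σ‴ = σ³℘′`
  (`PeriodPair.univExtP`),
* `Z₀ = σ²σ′ = σ³ζ`, `Z₁ = σ′³ - σσ′σ″ = σ³℘ζ`, `Z₂ = -σ′²σ″ - σσ′σ‴ + 2σσ″² = σ³(℘′ζ + 2℘²)`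
  (`PeriodPair.univExtZ`, the "`ζ`-companions"),
* `Θ_{inl i}(z, t) = Pᵢ(z)`, `Θ_{inr i}(z, t) = t Pᵢ(z) - Zᵢ(z)` (`PeriodPair.univExtTheta`), so that
  off the lattice `Θ = σ³ · (1, ℘, ℘′, ν, ℘ν, ℘′ν - 2℘²)`.

Everything below is PROVED: the blocks are entire (`differentiable_univExtP/Z`); their values
off the lattice (`univExtP_eq`, `univExtZ_eq`, `univExtTheta_eq`); the automorphy under the
generators `(ωⱼ, ηⱼ)` of `Λ♮` — `Pᵢ(z + ωⱼ) = χⱼ³ Pᵢ(z)`, `Zᵢ(z + ωⱼ) = χⱼ³ (Zᵢ(z) + ηⱼ Pᵢ(z))`,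
hence `Θ_I(z + ωⱼ, t + ηⱼ) = χⱼ(z)³ Θ_I(z, t)` for ALL `I` with the same nowhere-vanishing factor
(`univExtTheta_add_period`: `[Θ]` is a well-defined map on `E♮ = ℂ²/Λ♮`); the values over the
origin of `E`, `Θ(0, t) = (0, 0, -2, 0, -1, -2t)` (`univExtTheta_zero_left`: the ratio
`Θ_{inr 2}/Θ_{inl 2} = t` is the coordinate of the point `t ∈ 𝔾ₐ = F₀ ⊂ E♮`, matching
`PeriodPair.IsUnivExtAlgPoint`); and the order-two growth
`‖Θ_I(z, t)‖ ≤ (1 + ‖t‖) e^{C(1 + |z|²)}` (`exists_norm_univExtTheta_le`) needed for the Schwarz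
lemma in Baker's method (Baker–Wüstholz 2007, §6.8, p. 116: `log |f_i(z)| ≤ c₁ + c₂‖z‖²`).

## References

* A. Baker, G. Wüstholz, *Logarithmic Forms and Diophantine Geometry*, CUP 2007, §6.8 (p. 116,
  the functions `f_i = X_i(φ(exp_G))` and their growth), proof of Thm. 6.3 (coordinates
  `℘, ℘′, z₋₁ + M″(ζ)` of the `𝔾ₐ`-extension).
* E. T. Whittaker, G. N. Watson, *A Course of Modern Analysis*, §§20.4–20.421, 20.53
  (`σ, ζ, ℘`; the classical expressions of `℘, ℘′` through `σ` and its derivatives).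
* G. Faltings, G. Wüstholz, *Einbettungen kommutativer algebraischer Gruppen und einige ihrer
  Eigenschaften*, J. reine angew. Math. 354 (1984), 175–205 (projective embeddings of
  commutative algebraic groups by theta functions; cited as [92] in Baker–Wüstholz).
-/

noncomputable section

open Complex Filter Topology
open scoped PeriodPair

namespace Literature.NumberTheory.Transcendental

variable (L : PeriodPair)

/-! ### The blocks `P₀, P₁, P₂` and `Z₀, Z₁, Z₂` -/

/-- The **`E`-blocks** `P₀ = σ³`, `P₁ = σ(σ′² - σσ″)`, `P₂ = 3σσ′σ″ - 2σ′³ - σ²σ‴` — entire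
functions equal to `σ³, σ³℘, σ³℘′` off the lattice (Whittaker–Watson §20.53 for
`℘ = -(d/dz)²log σ`). [folklore] -/
def _root_.PeriodPair.univExtP (i : Fin 3) (z : ℂ) : ℂ :=
  ![L.sigmaDeriv 0 z ^ 3,
    L.sigmaDeriv 0 z * (L.sigmaDeriv 1 z ^ 2 - L.sigmaDeriv 0 z * L.sigmaDeriv 2 z),
    3 * L.sigmaDeriv 0 z * L.sigmaDeriv 1 z * L.sigmaDeriv 2 z - 2 * L.sigmaDeriv 1 z ^ 3 -
      L.sigmaDeriv 0 z ^ 2 * L.sigmaDeriv 3 z] i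

/-- The **`ζ`-companions** `Z₀ = σ²σ′`, `Z₁ = σ′³ - σσ′σ″`, `Z₂ = -σ′²σ″ - σσ′σ‴ + 2σσ″²` — entire
functions equal to `σ³ζ, σ³℘ζ, σ³(℘′ζ + 2℘²)` off the lattice. [folklore] -/
def _root_.PeriodPair.univExtZ (i : Fin 3) (z : ℂ) : ℂ :=
  ![L.sigmaDeriv 0 z ^ 2 * L.sigmaDeriv 1 z,
    L.sigmaDeriv 1 z ^ 3 - L.sigmaDeriv 0 z * L.sigmaDeriv 1 z * L.sigmaDeriv 2 z,
    -(L.sigmaDeriv 1 z ^ 2 * L.sigmaDeriv 2 z) - L.sigmaDeriv 0 z * L.sigmaDeriv 1 z * L.sigmaDeriv 3 z +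
      2 * L.sigmaDeriv 0 z * L.sigmaDeriv 2 z ^ 2] i

/-- The **theta functions of `E♮`** on `Lie E♮_ℂ = ℂ²`, indexed by `Fin 3 ⊕ Fin 3`:
`Θ_{inl i}(z, t) = Pᵢ(z)` and `Θ_{inr i}(z, t) = t Pᵢ(z) - Zᵢ(z)`; off the lattice
`Θ = σ(z)³ · (1, ℘, ℘′, ν, ℘ν, ℘′ν - 2℘²)` with `ν = t - ζ(z)`, the projective coordinates of
`exp_{E♮}(z, t)` in the linear system `|3F₀ + D_∞|` (module docstring). [folklore] -/
def _root_.PeriodPair.univExtTheta : Fin 3 ⊕ Fin 3 → ℂ × ℂ → ℂ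
  | Sum.inl i, v => L.univExtP i v.1
  | Sum.inr i, v => v.2 * L.univExtP i v.1 - L.univExtZ i v.1

/-- `P₀ = σ³`. [folklore] -/
theorem _root_.PeriodPair.univExtP_zero (z : ℂ) : L.univExtP 0 z = L.sigmaDeriv 0 z ^ 3 := rfl

/-- `P₁ = σ(σ′² - σσ″)`. [folklore] -/
theorem _root_.PeriodPair.univExtP_one (z : ℂ) :
    L.univExtP 1 z = L.sigmaDeriv 0 z * (L.sigmaDeriv 1 z ^ 2 - L.sigmaDeriv 0 z * L.sigmaDeriv 2 z) :=
  rfl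

/-- `P₂ = 3σσ′σ″ - 2σ′³ - σ²σ‴`. [folklore] -/
theorem _root_.PeriodPair.univExtP_two (z : ℂ) :
    L.univExtP 2 z = 3 * L.sigmaDeriv 0 z * L.sigmaDeriv 1 z * L.sigmaDeriv 2 z -
      2 * L.sigmaDeriv 1 z ^ 3 - L.sigmaDeriv 0 z ^ 2 * L.sigmaDeriv 3 z :=
  rfl

/-- `Z₀ = σ²σ′`. [folklore] -/
theorem _root_.PeriodPair.univExtZ_zero (z : ℂ) :
    L.univExtZ 0 z = L.sigmaDeriv 0 z ^ 2 * L.sigmaDeriv 1 z := rfl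

/-- `Z₁ = σ′³ - σσ′σ″`. [folklore] -/
theorem _root_.PeriodPair.univExtZ_one (z : ℂ) :
    L.univExtZ 1 z = L.sigmaDeriv 1 z ^ 3 - L.sigmaDeriv 0 z * L.sigmaDeriv 1 z * L.sigmaDeriv 2 z :=
  rfl

/-- `Z₂ = -σ′²σ″ - σσ′σ‴ + 2σσ″²`. [folklore] -/
theorem _root_.PeriodPair.univExtZ_two (z : ℂ) :
    L.univExtZ 2 z = -(L.sigmaDeriv 1 z ^ 2 * L.sigmaDeriv 2 z) -
      L.sigmaDeriv 0 z * L.sigmaDeriv 1 z * L.sigmaDeriv 3 z +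
        2 * L.sigmaDeriv 0 z * L.sigmaDeriv 2 z ^ 2 :=
  rfl

/-- `Θ_{inl i}(z, t) = Pᵢ(z)`. [folklore] -/
@[simp] theorem _root_.PeriodPair.univExtTheta_inl (i : Fin 3) (v : ℂ × ℂ) :
    L.univExtTheta (Sum.inl i) v = L.univExtP i v.1 := rfl

/-- `Θ_{inr i}(z, t) = t Pᵢ(z) - Zᵢ(z)`. [folklore] -/
@[simp] theorem _root_.PeriodPair.univExtTheta_inr (i : Fin 3) (v : ℂ × ℂ) :
    L.univExtTheta (Sum.inr i) v = v.2 * L.univExtP i v.1 - L.univExtZ i v.1 := rfl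

/-! ### Holomorphy -/

/-- The blocks `Pᵢ` are entire. [folklore] -/
theorem _root_.PeriodPair.differentiable_univExtP (i : Fin 3) : Differentiable ℂ (L.univExtP i) := by
  have hd := L.differentiable_sigmaDeriv
  fin_cases i
  · show Differentiable ℂ fun z => L.univExtP 0 z
    simp only [PeriodPair.univExtP_zero]
    exact (hd 0).pow 3
  · show Differentiable ℂ fun z => L.univExtP 1 z
    simp only [PeriodPair.univExtP_one]
    exact (hd 0).mul (((hd 1).pow 2).sub ((hd 0).mul (hd 2)))
  · show Differentiable ℂ fun z => L.univExtP 2 z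
    simp only [PeriodPair.univExtP_two]
    exact (((((differentiable_const _).mul (hd 0)).mul (hd 1)).mul (hd 2)).sub
      ((differentiable_const _).mul ((hd 1).pow 3))).sub (((hd 0).pow 2).mul (hd 3))

/-- The companions `Zᵢ` are entire. [folklore] -/
theorem _root_.PeriodPair.differentiable_univExtZ (i : Fin 3) : Differentiable ℂ (L.univExtZ i) := by
  have hd := L.differentiable_sigmaDeriv
  fin_cases i
  · show Differentiable ℂ fun z => L.univExtZ 0 z
    simp only [PeriodPair.univExtZ_zero]
    exact ((hd 0).pow 2).mul (hd 1)
  · show Differentiable ℂ fun z => L.univExtZ 1 z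
    simp only [PeriodPair.univExtZ_one]
    exact ((hd 1).pow 3).sub (((hd 0).mul (hd 1)).mul (hd 2))
  · show Differentiable ℂ fun z => L.univExtZ 2 z
    simp only [PeriodPair.univExtZ_two]
    exact ((((hd 1).pow 2).mul (hd 2)).neg.sub (((hd 0).mul (hd 1)).mul (hd 3))).add
      (((differentiable_const _).mul (hd 0)).mul ((hd 2).pow 2))

/-! ### Values off the lattice -/

variable {L}

/-- **Off the lattice `P = σ³ · (1, ℘, ℘′)`** (Whittaker–Watson §20.53: `℘ = ζ² - σ″/σ`, i.e.
`σ³℘ = σ(σ′² - σσ″)`, and its derivative). [cite: WhittakerWatson1927, §20.53] -/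
theorem _root_.PeriodPair.univExtP_eq {z : ℂ} (hz : z ∉ L.lattice) :
    L.univExtP 0 z = L.weierstrassSigma z ^ 3 ∧
    L.univExtP 1 z = L.weierstrassSigma z ^ 3 * ℘[L] z ∧
    L.univExtP 2 z = L.weierstrassSigma z ^ 3 * ℘'[L] z := by
  simp only [PeriodPair.univExtP_zero, PeriodPair.univExtP_one, PeriodPair.univExtP_two,
    PeriodPair.sigmaDeriv_zero_eq, L.sigmaDeriv_one_eq hz, L.sigmaDeriv_two_eq hz,
    L.sigmaDeriv_three_eq hz]
  exact ⟨trivial, by ring, by ring⟩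

/-- **Off the lattice `Z = σ³ · (ζ, ℘ζ, ℘′ζ + 2℘²)`.** [folklore] -/
theorem _root_.PeriodPair.univExtZ_eq {z : ℂ} (hz : z ∉ L.lattice) :
    L.univExtZ 0 z = L.weierstrassSigma z ^ 3 * L.weierstrassZeta z ∧
    L.univExtZ 1 z = L.weierstrassSigma z ^ 3 * (℘[L] z * L.weierstrassZeta z) ∧
    L.univExtZ 2 z = L.weierstrassSigma z ^ 3 *
      (℘'[L] z * L.weierstrassZeta z + 2 * ℘[L] z ^ 2) := by
  simp only [PeriodPair.univExtZ_zero, PeriodPair.univExtZ_one, PeriodPair.univExtZ_two,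
    PeriodPair.sigmaDeriv_zero_eq, L.sigmaDeriv_one_eq hz, L.sigmaDeriv_two_eq hz,
    L.sigmaDeriv_three_eq hz]
  exact ⟨by ring, by ring, by ring⟩

/-- **Off the lattice `Θ(z, t) = σ(z)³ · (1, ℘, ℘′, ν, ℘ν, ℘′ν - 2℘²)`, `ν = t - ζ(z)`**: the
theta functions are `σ³` times the affine coordinates `(x, y, ν)` of `exp_{E♮}(z, t)` and the two
further sections `xν`, `yν - 2x²` of `|3F₀ + D_∞|`. [folklore] -/
theorem _root_.PeriodPair.univExtTheta_eq {z : ℂ} (hz : z ∉ L.lattice) (t : ℂ) :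
    L.univExtTheta (Sum.inl 0) (z, t) = L.weierstrassSigma z ^ 3 ∧
    L.univExtTheta (Sum.inl 1) (z, t) = L.weierstrassSigma z ^ 3 * ℘[L] z ∧
    L.univExtTheta (Sum.inl 2) (z, t) = L.weierstrassSigma z ^ 3 * ℘'[L] z ∧
    L.univExtTheta (Sum.inr 0) (z, t) = L.weierstrassSigma z ^ 3 * (t - L.weierstrassZeta z) ∧
    L.univExtTheta (Sum.inr 1) (z, t) =
      L.weierstrassSigma z ^ 3 * (℘[L] z * (t - L.weierstrassZeta z)) ∧
    L.univExtTheta (Sum.inr 2) (z, t) =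
      L.weierstrassSigma z ^ 3 * (℘'[L] z * (t - L.weierstrassZeta z) - 2 * ℘[L] z ^ 2) := by
  obtain ⟨p0, p1, p2⟩ := PeriodPair.univExtP_eq hz
  obtain ⟨z0, z1, z2⟩ := PeriodPair.univExtZ_eq hz
  simp only [PeriodPair.univExtTheta_inl, PeriodPair.univExtTheta_inr, p0, p1, p2, z0, z1, z2]
  exact ⟨trivial, trivial, trivial, by ring, by ring, by ring⟩

/-! ### Automorphy under the generators `(ωⱼ, ηⱼ)` of the kernel `Λ♮` -/

variable (L)

/-- **The blocks under `z ↦ z + ωⱼ`** (`j = 1, 2`): `Pᵢ(z + ωⱼ) = χⱼ(z)³ Pᵢ(z)` and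
`Zᵢ(z + ωⱼ) = χⱼ(z)³ (Zᵢ(z) + ηⱼ Pᵢ(z))`, with the automorphy factor `χⱼ = PeriodPair.sigmaAut`
of `σ` — polynomial consequences of the jet transformation rules of `SigmaJets.lean`
(ultimately of `σ(z + ω) = χσ(z)`, `ζ(z + ω) = ζ(z) + η`). [cite: WhittakerWatson1927, §20.421] -/
theorem _root_.PeriodPair.univExtP_univExtZ_add_period (j : Fin 2) (i : Fin 3) (z : ℂ) :
    L.univExtP i (z + L.basis j) = L.sigmaAut j z ^ 3 * L.univExtP i z ∧
    L.univExtZ i (z + L.basis j) =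
      L.sigmaAut j z ^ 3 * (L.univExtZ i z + L.quasiPeriod j * L.univExtP i z) := by
  obtain ⟨h0, h1, h2, h3⟩ := L.sigmaDeriv_add_period j z
  fin_cases i
  · refine ⟨?_, ?_⟩
    · show L.univExtP 0 _ = _ * L.univExtP 0 z
      simp only [PeriodPair.univExtP_zero, h0]; ring
    · show L.univExtZ 0 _ = _ * (L.univExtZ 0 z + _ * L.univExtP 0 z)
      simp only [PeriodPair.univExtZ_zero, PeriodPair.univExtP_zero, h0, h1]; ring
  · refine ⟨?_, ?_⟩
    · show L.univExtP 1 _ = _ * L.univExtP 1 z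
      simp only [PeriodPair.univExtP_one, h0, h1, h2]; ring
    · show L.univExtZ 1 _ = _ * (L.univExtZ 1 z + _ * L.univExtP 1 z)
      simp only [PeriodPair.univExtZ_one, PeriodPair.univExtP_one, h0, h1, h2]; ring
  · refine ⟨?_, ?_⟩
    · show L.univExtP 2 _ = _ * L.univExtP 2 z
      simp only [PeriodPair.univExtP_two, h0, h1, h2, h3]; ring
    · show L.univExtZ 2 _ = _ * (L.univExtZ 2 z + _ * L.univExtP 2 z)
      simp only [PeriodPair.univExtZ_two, PeriodPair.univExtP_two, h0, h1, h2, h3]; ring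

/-- **Automorphy of the theta functions under the kernel generators**: for `j = 1, 2`, every
index `I` and all `(z, t)`, `Θ_I(z + ωⱼ, t + ηⱼ) = χⱼ(z)³ · Θ_I(z, t)` with one and the same
nowhere-vanishing factor — so `(z, t) ↦ [Θ(z, t)]` factors through `E♮(ℂ) = ℂ²/Λ♮`,
`Λ♮ = ℤ(ω₁, η₁) + ℤ(ω₂, η₂)`. [folklore] -/
theorem _root_.PeriodPair.univExtTheta_add_period (j : Fin 2) (I : Fin 3 ⊕ Fin 3) (z t : ℂ) :
    L.univExtTheta I (z + L.basis j, t + L.quasiPeriod j) =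
      L.sigmaAut j z ^ 3 * L.univExtTheta I (z, t) := by
  rcases I with i | i
  · exact (L.univExtP_univExtZ_add_period j i z).1
  · obtain ⟨hP, hZ⟩ := L.univExtP_univExtZ_add_period j i z
    simp only [PeriodPair.univExtTheta_inr, hP, hZ]
    ring

/-! ### Values over the origin of `E` -/

/-- `P(0) = (0, 0, -2)`: over `0 ∈ E` only the `℘′`-coordinate survives (`σ(0) = 0`, `σ′(0) = 1`).
[folklore] -/
theorem _root_.PeriodPair.univExtP_at_zero :
    L.univExtP 0 0 = 0 ∧ L.univExtP 1 0 = 0 ∧ L.univExtP 2 0 = -2 := by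
  simp only [PeriodPair.univExtP_zero, PeriodPair.univExtP_one, PeriodPair.univExtP_two,
    L.sigmaDeriv_zero_zero, L.sigmaDeriv_one_zero, L.sigmaDeriv_two_zero]
  norm_num

/-- `Z(0) = (0, 1, 0)` (`σ″(0) = 0`). [folklore] -/
theorem _root_.PeriodPair.univExtZ_at_zero :
    L.univExtZ 0 0 = 0 ∧ L.univExtZ 1 0 = 1 ∧ L.univExtZ 2 0 = 0 := by
  simp only [PeriodPair.univExtZ_zero, PeriodPair.univExtZ_one, PeriodPair.univExtZ_two,
    L.sigmaDeriv_zero_zero, L.sigmaDeriv_one_zero, L.sigmaDeriv_two_zero]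
  norm_num

/-- **`Θ(0, t) = (0, 0, -2, 0, -1, -2t)`**: the point `exp_{E♮}(0, t) = t ∈ 𝔾ₐ = F₀ ⊂ E♮` has
projective coordinates `[0 : 0 : -2 : 0 : -1 : -2t]`, with affine ratio
`Θ_{inr 2}/Θ_{inl 2} = t`, the `𝔾ₐ`-coordinate of the point used in
`PeriodPair.IsUnivExtAlgPoint` (`z = 0·ω₁ + 0·ω₂`, point `t - 0`). [folklore] -/
theorem _root_.PeriodPair.univExtTheta_zero_left (t : ℂ) :
    L.univExtTheta (Sum.inl 0) (0, t) = 0 ∧ L.univExtTheta (Sum.inl 1) (0, t) = 0 ∧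
    L.univExtTheta (Sum.inl 2) (0, t) = -2 ∧ L.univExtTheta (Sum.inr 0) (0, t) = 0 ∧
    L.univExtTheta (Sum.inr 1) (0, t) = -1 ∧ L.univExtTheta (Sum.inr 2) (0, t) = -2 * t := by
  obtain ⟨p0, p1, p2⟩ := L.univExtP_at_zero
  obtain ⟨z0, z1, z2⟩ := L.univExtZ_at_zero
  simp only [PeriodPair.univExtTheta_inl, PeriodPair.univExtTheta_inr, p0, p1, p2, z0, z1, z2]
  norm_num
  ring

/-! ### Growth of order two -/

/-- Triple products of quantities bounded by `E ≥ 0` are bounded by `E³`. [folklore] -/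
theorem norm_mul_mul_le_cube {a b c : ℂ} {E : ℝ} (hE : 0 ≤ E) (ha : ‖a‖ ≤ E) (hb : ‖b‖ ≤ E)
    (hc : ‖c‖ ≤ E) : ‖a * b * c‖ ≤ E ^ 3 := by
  rw [norm_mul, norm_mul, pow_succ, pow_two]
  exact mul_le_mul (mul_le_mul ha hb (norm_nonneg _) hE) hc (norm_nonneg _)
    (mul_nonneg hE hE)

/-- **Growth of the blocks**: one constant `C ≥ 0` with `‖Pᵢ(z)‖, ‖Zᵢ(z)‖ ≤ e^{C(1 + |z|²)}`
for all `i` (each block is a sum of at most three cubic monomials in the sigma jets, with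
coefficients at most `3`; `6e^{3C₀(1+|z|²)} ≤ e^{(3C₀+6)(1+|z|²)}`). [folklore] -/
theorem _root_.PeriodPair.exists_norm_univExtP_univExtZ_le :
    ∃ C : ℝ, 0 ≤ C ∧ ∀ (i : Fin 3) (z : ℂ),
      ‖L.univExtP i z‖ ≤ Real.exp (C * (1 + ‖z‖ ^ 2)) ∧
      ‖L.univExtZ i z‖ ≤ Real.exp (C * (1 + ‖z‖ ^ 2)) := by
  obtain ⟨C, hC0, hC⟩ := L.exists_norm_sigmaDeriv_le_exp
  refine ⟨3 * C + 6, by positivity, fun i z => ?_⟩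
  set E : ℝ := Real.exp (C * (1 + ‖z‖ ^ 2)) with hE
  have hE0 : 0 ≤ E := (Real.exp_pos _).le
  have hs : ∀ n ≤ 3, ‖L.sigmaDeriv n z‖ ≤ E := fun n hn => hC n hn z
  have h0 := hs 0 (by norm_num)
  have h1 := hs 1 (by norm_num)
  have h2 := hs 2 (by norm_num)
  have h3 := hs 3 (by norm_num)
  -- every cubic monomial in the jets is bounded by `E³`
  have cube : ∀ {a b c : ℂ}, ‖a‖ ≤ E → ‖b‖ ≤ E → ‖c‖ ≤ E → ‖a * b * c‖ ≤ E ^ 3 :=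
    fun ha hb hc => norm_mul_mul_le_cube hE0 ha hb hc
  -- `6 E³ ≤ e^{(3C+6)(1+|z|²)}`
  have hfin : 6 * E ^ 3 ≤ Real.exp ((3 * C + 6) * (1 + ‖z‖ ^ 2)) := by
    have h6 : (6 : ℝ) ≤ Real.exp 6 := by
      have := Real.add_one_le_exp (6 : ℝ)
      linarith
    have hE3 : E ^ 3 = Real.exp (3 * C * (1 + ‖z‖ ^ 2)) := by
      rw [hE, ← Real.exp_nat_mul]; congr 1; push_cast; ring
    have hz1 : (1 : ℝ) ≤ 1 + ‖z‖ ^ 2 := by nlinarith [norm_nonneg z]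
    calc 6 * E ^ 3 ≤ Real.exp 6 * Real.exp (3 * C * (1 + ‖z‖ ^ 2)) := by
          rw [hE3]; exact mul_le_mul_of_nonneg_right h6 (Real.exp_pos _).le
      _ = Real.exp (3 * C * (1 + ‖z‖ ^ 2) + 6) := by rw [← Real.exp_add]; ring_nf
      _ ≤ Real.exp ((3 * C + 6) * (1 + ‖z‖ ^ 2)) := Real.exp_le_exp.mpr (by nlinarith)
  have hE3pos : 0 ≤ E ^ 3 := by positivity
  -- abbreviations
  set s0 := L.sigmaDeriv 0 z
  set s1 := L.sigmaDeriv 1 z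
  set s2 := L.sigmaDeriv 2 z
  set s3 := L.sigmaDeriv 3 z
  have n3 : ‖(3 : ℂ)‖ = 3 := by norm_num
  have n2 : ‖(2 : ℂ)‖ = 2 := by norm_num
  fin_cases i <;> refine ⟨?_, ?_⟩
  · -- `P₀ = σ³`
    show ‖L.univExtP 0 z‖ ≤ _
    rw [PeriodPair.univExtP_zero]
    calc ‖s0 ^ 3‖ = ‖s0 * s0 * s0‖ := by ring_nf
      _ ≤ E ^ 3 := cube h0 h0 h0
      _ ≤ 6 * E ^ 3 := by nlinarith
      _ ≤ _ := hfin
  · -- `Z₀ = σ²σ′`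
    show ‖L.univExtZ 0 z‖ ≤ _
    rw [PeriodPair.univExtZ_zero]
    calc ‖s0 ^ 2 * s1‖ = ‖s0 * s0 * s1‖ := by ring_nf
      _ ≤ E ^ 3 := cube h0 h0 h1
      _ ≤ 6 * E ^ 3 := by nlinarith
      _ ≤ _ := hfin
  · -- `P₁ = σσ′² - σ²σ″`
    show ‖L.univExtP 1 z‖ ≤ _
    rw [PeriodPair.univExtP_one]
    calc ‖s0 * (s1 ^ 2 - s0 * s2)‖ = ‖s0 * s1 * s1 - s0 * s0 * s2‖ := by ring_nf
      _ ≤ ‖s0 * s1 * s1‖ + ‖s0 * s0 * s2‖ := norm_sub_le _ _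
      _ ≤ E ^ 3 + E ^ 3 := add_le_add (cube h0 h1 h1) (cube h0 h0 h2)
      _ ≤ 6 * E ^ 3 := by nlinarith
      _ ≤ _ := hfin
  · -- `Z₁ = σ′³ - σσ′σ″`
    show ‖L.univExtZ 1 z‖ ≤ _
    rw [PeriodPair.univExtZ_one]
    calc ‖s1 ^ 3 - s0 * s1 * s2‖ = ‖s1 * s1 * s1 - s0 * s1 * s2‖ := by ring_nf
      _ ≤ ‖s1 * s1 * s1‖ + ‖s0 * s1 * s2‖ := norm_sub_le _ _
      _ ≤ E ^ 3 + E ^ 3 := add_le_add (cube h1 h1 h1) (cube h0 h1 h2)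
      _ ≤ 6 * E ^ 3 := by nlinarith
      _ ≤ _ := hfin
  · -- `P₂ = 3σσ′σ″ - 2σ′³ - σ²σ‴`
    show ‖L.univExtP 2 z‖ ≤ _
    rw [PeriodPair.univExtP_two]
    calc ‖3 * s0 * s1 * s2 - 2 * s1 ^ 3 - s0 ^ 2 * s3‖
        = ‖(3 : ℂ) * (s0 * s1 * s2) - (2 : ℂ) * (s1 * s1 * s1) - s0 * s0 * s3‖ := by ring_nf
      _ ≤ ‖(3 : ℂ) * (s0 * s1 * s2)‖ + ‖(2 : ℂ) * (s1 * s1 * s1)‖ + ‖s0 * s0 * s3‖ := by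
          exact (norm_sub_le _ _).trans (add_le_add (norm_sub_le _ _) le_rfl)
      _ ≤ 3 * E ^ 3 + 2 * E ^ 3 + E ^ 3 := by
          rw [norm_mul, norm_mul (2 : ℂ), n3, n2]
          exact add_le_add (add_le_add (mul_le_mul_of_nonneg_left (cube h0 h1 h2) (by norm_num))
            (mul_le_mul_of_nonneg_left (cube h1 h1 h1) (by norm_num))) (cube h0 h0 h3)
      _ ≤ 6 * E ^ 3 := by nlinarith
      _ ≤ _ := hfin
  · -- `Z₂ = -σ′²σ″ - σσ′σ‴ + 2σσ″²`
    show ‖L.univExtZ 2 z‖ ≤ _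
    rw [PeriodPair.univExtZ_two]
    calc ‖-(s1 ^ 2 * s2) - s0 * s1 * s3 + 2 * s0 * s2 ^ 2‖
        = ‖(2 : ℂ) * (s0 * s2 * s2) - s1 * s1 * s2 - s0 * s1 * s3‖ := by ring_nf
      _ ≤ ‖(2 : ℂ) * (s0 * s2 * s2)‖ + ‖s1 * s1 * s2‖ + ‖s0 * s1 * s3‖ := by
          exact (norm_sub_le _ _).trans (add_le_add (norm_sub_le _ _) le_rfl)
      _ ≤ 2 * E ^ 3 + E ^ 3 + E ^ 3 := by
          rw [norm_mul, n2]
          exact add_le_add (add_le_add (mul_le_mul_of_nonneg_left (cube h0 h2 h2) (by norm_num))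
            (cube h1 h1 h2)) (cube h0 h1 h3)
      _ ≤ 6 * E ^ 3 := by nlinarith
      _ ≤ _ := hfin

/-- **Order-two growth of the theta functions of `E♮`**: one constant `C ≥ 0` with
`‖Θ_I(z, t)‖ ≤ (1 + ‖t‖) · e^{C(1 + |z|²)}` for all `I` and `(z, t)` — the growth
`log |f_i| ≤ c₁ + c₂‖·‖²` of the coordinates of `exp_G` used with the Schwarz lemma in Baker's
method (Baker–Wüstholz 2007, §6.8, p. 116). [cite: BakerWustholz2007, §6.8 (p. 116)] -/
theorem _root_.PeriodPair.exists_norm_univExtTheta_le :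
    ∃ C : ℝ, 0 ≤ C ∧ ∀ (I : Fin 3 ⊕ Fin 3) (z t : ℂ),
      ‖L.univExtTheta I (z, t)‖ ≤ (1 + ‖t‖) * Real.exp (C * (1 + ‖z‖ ^ 2)) := by
  obtain ⟨C, hC0, hC⟩ := L.exists_norm_univExtP_univExtZ_le
  refine ⟨C, hC0, fun I z t => ?_⟩
  have hE := (Real.exp_pos (C * (1 + ‖z‖ ^ 2))).le
  rcases I with i | i
  · rw [PeriodPair.univExtTheta_inl]
    calc ‖L.univExtP i z‖ ≤ Real.exp (C * (1 + ‖z‖ ^ 2)) := (hC i z).1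
      _ = 1 * Real.exp (C * (1 + ‖z‖ ^ 2)) := (one_mul _).symm
      _ ≤ (1 + ‖t‖) * Real.exp (C * (1 + ‖z‖ ^ 2)) := by gcongr; nlinarith [norm_nonneg t]
  · rw [PeriodPair.univExtTheta_inr]
    calc ‖t * L.univExtP i z - L.univExtZ i z‖
        ≤ ‖t * L.univExtP i z‖ + ‖L.univExtZ i z‖ := norm_sub_le _ _
      _ ≤ ‖t‖ * Real.exp (C * (1 + ‖z‖ ^ 2)) + Real.exp (C * (1 + ‖z‖ ^ 2)) := by
          rw [norm_mul]
          exact add_le_add (mul_le_mul_of_nonneg_left (hC i z).1 (norm_nonneg _)) (hC i z).2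
      _ = (1 + ‖t‖) * Real.exp (C * (1 + ‖z‖ ^ 2)) := by ring

end Literature.NumberTheory.Transcendental

end
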